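import Summits.BirchSwinnertonDyer.BirchSwinnertonDyer.Theorems.CyclotomicUntwistPSUntwistedTraceDefs
import Mathlib.NumberTheory.Padics.Complex
import HarnessLib

/-!
# LAW L-a3: the admissible root `α` lies in ANY coefficient field containing `√−3` — the clause
# `α² − a_w(W)·α + 3 = 0` has discriminant `a_w² − 12 ∈ {−12, −3}` (route `CyclotomicUntwist`, cruxes K1 / K2)

Cell `pub/bsd-wall` (D-0145 line `route-BirchSwinnertonDyer-CyclotomicUntwist`), seat `bsd-line-cycu-p3` (gen 6).
Helper toward K1 (stmt-BirchSwinnertonDyer-21580) / K2 (stmt-21581). THEOREMS ONLY (no definition, no named fact,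
no `sorry`); BSD is not proved by this file and no crux is.

WHY. cycu-p5 g5's rationality/conjugation lane (`CyclotomicUntwistConjugateLFunctionsThree`, T1/T2) and the pin transfer
(`CyclotomicUntwistConjugatePin.exists_pinned_transfer`) work over a coefficient field `ι : K → ℂ₃` (intended
`K = ℚ₃(ζ₃)`) and take `α = ι α_K` as a HYPOTHESIS («MTT's `ℚ_p(ζ₃)`-valuedness is a property a consumer may add»,
D1 docstring). With the intrinsic clause of the K-SEP′ children this is AUTOMATIC: `a_w(W) ∈ {0, ±3}`
(`psUntwistedTrace_eq_or`), so `X² − a_w X + 3` has discriminant `−12` or `−3` and splits in every field containing a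
square root of `−3`; hence every `α ∈ ℂ₃` with `α² − a_w(W)·α + 3 = 0` is `ι α_K` for a root `α_K ∈ K` of the same
polynomial, for ANY ring hom `ι : K → ℂ₃` from a field `K ∋ δ₀`, `δ₀² = −3`.

* `sq_two_mul_sub_eq` — `x² − a x + 3 = 0 ⟹ (2x − a)² = a² − 12` (any commutative ring);
* `exists_preimage_root` — fields `K`, `F` of characteristic `≠ 2`, `ι : K →+* F`, `δ ∈ K` with `δ² = a² − 12`:
  every root `x ∈ F` of `X² − aX + 3` is `ι y` for a root `y ∈ K`;
* **`exists_preimage_root_trace`** — the route's instance: `ι : K →+* ℂ₃`, `δ₀ ∈ K`, `δ₀² = −3`,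
  `α² − (W.psUntwistedTrace)·α + 3 = 0` ⟹ `∃ α_K : K, ι α_K = α ∧ α_K² − (W.psUntwistedTrace)·α_K + 3 = 0`
  (`δ := 2δ₀` if `a_w = 0`, `δ := δ₀` if `a_w = ±3`);
* `root_mem_range_trace` — `α ∈ Set.range ι`.

References: B. Mazur, J. Tate, J. Teitelbaum, Invent. Math. 84 (1986) §I.10 (values in `ℚ_p(α)`), §I.14
[MazurTateTeitelbaum1986Invent]; A. Kraus, Manuscripta Math. 69 (1990) [Kraus1990].
-/

set_option autoImplicit false
-- single-conjunct summit: `Summit.BirchSwinnertonDyer.BirchSwinnertonDyer.…` repeats the name by design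
set_option linter.dupNamespace false

namespace Summit.BirchSwinnertonDyer.BirchSwinnertonDyer.Theorems.PSUntwistedTrace

/-! ### Generic algebra of `X² − aX + 3` -/

section Generic

/-- `x² − a x + 3 = 0 ⟹ (2x − a)² = a² − 12`. [folklore] -/
theorem sq_two_mul_sub_eq {R : Type*} [CommRing R] {x a : R} (h : x ^ 2 - a * x + 3 = 0) :
    (2 * x - a) ^ 2 = a ^ 2 - 12 := by
  linear_combination 4 * h

/-- **Roots descend to any subfield containing a square root of the discriminant.** For fields `K`, `F` with
`(2 : F) ≠ 0`, a ring hom `ι : K →+* F`, and `δ ∈ K` with `δ² = a² − 12`: every `x ∈ F` with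
`x² − ι(a)·x + 3 = 0` is `ι y` for some `y ∈ K` with `y² − a y + 3 = 0` (namely `y = (a ± δ)/2`). [folklore] -/
theorem exists_preimage_root {K F : Type*} [Field K] [Field F] (ι : K →+* F) (h2 : (2 : F) ≠ 0) {a δ : K}
    (hδ : δ ^ 2 = a ^ 2 - 12) {x : F} (h : x ^ 2 - ι a * x + 3 = 0) :
    ∃ y : K, ι y = x ∧ y ^ 2 - a * y + 3 = 0 := by
  have h2K : (2 : K) ≠ 0 := by
    intro h0
    have h' : ι 2 = ι 0 := congrArg ι h0
    rw [map_ofNat, map_zero] at h'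
    exact h2 h'
  have hιδ : (ι δ) ^ 2 = (ι a) ^ 2 - 12 := by
    rw [← map_pow, hδ, map_sub, map_pow, map_ofNat]
  have hsq : (2 * x - ι a) ^ 2 = (ι δ) ^ 2 := by rw [hιδ]; exact sq_two_mul_sub_eq h
  rcases sq_eq_sq_iff_eq_or_eq_neg.mp hsq with hx | hx
  · refine ⟨(a + δ) / 2, ?_, ?_⟩
    · rw [map_div₀, map_add, map_ofNat, div_eq_iff h2]
      linear_combination -hx
    · field_simp
      linear_combination hδ
  · refine ⟨(a - δ) / 2, ?_, ?_⟩
    · rw [map_div₀, map_sub, map_ofNat, div_eq_iff h2]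
      linear_combination -hx
    · field_simp
      linear_combination hδ

end Generic

/-! ### The route's instance: `a = a_w(W) ∈ {0, ±3}`, discriminant `−12` or `−3` -/

section Trace

variable {K : Type*} [Field K] (ι : K →+* ℂ_[3]) {δ₀ : K} (hδ₀ : δ₀ ^ 2 = -3)
  {W : WeierstrassCurve ℚ} {α : ℂ_[3]}

include hδ₀ in
/-- **Every admissible root is `K`-rational for `K ∋ √−3`.** For a field `K` with `δ₀² = −3`, a ring hom
`ι : K →+* ℂ₃`, and `α ∈ ℂ₃` with `α² − a_w(W)·α + 3 = 0`: there is `α_K ∈ K` with `ι α_K = α` and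
`α_K² − a_w(W)·α_K + 3 = 0`. (`a_w(W) ∈ {0, ±3}`, so `a_w² − 12 = (2δ₀)²` or `δ₀²`.) So the hypothesis «`α = ι α_K`» of
the conjugate/rationality lemmas (`CyclotomicUntwistConjugateLFunctionsThree`, `…ConjugatePin`) is free under the
K-SEP′ clause. [cite: MazurTateTeitelbaum1986Invent, §I.10 and §I.14] [cite: Kraus1990, Théorème (p = 3)] -/
theorem exists_preimage_root_trace (h : α ^ 2 - ((W.psUntwistedTrace : ℤ) : ℂ_[3]) * α + 3 = 0) :
    ∃ αK : K, ι αK = α ∧ αK ^ 2 - ((W.psUntwistedTrace : ℤ) : K) * αK + 3 = 0 := by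
  have h2 : (2 : ℂ_[3]) ≠ 0 := two_ne_zero
  have hι : ι ((W.psUntwistedTrace : ℤ) : K) = ((W.psUntwistedTrace : ℤ) : ℂ_[3]) := map_intCast ι _
  rw [← hι] at h
  rcases psUntwistedTrace_eq_or W with ha | ha | ha
  · refine exists_preimage_root ι h2 (δ := 2 * δ₀) ?_ h
    rw [ha]; push_cast; linear_combination 4 * hδ₀
  · refine exists_preimage_root ι h2 (δ := δ₀) ?_ h
    rw [ha]; push_cast; linear_combination hδ₀
  · refine exists_preimage_root ι h2 (δ := δ₀) ?_ h
    rw [ha]; push_cast; linear_combination hδ₀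

include hδ₀ in
/-- `α ∈ range ι` for every root of the clause (coefficient field `K ∋ √−3`). [folklore] -/
theorem root_mem_range_trace (h : α ^ 2 - ((W.psUntwistedTrace : ℤ) : ℂ_[3]) * α + 3 = 0) :
    α ∈ Set.range ι := by
  obtain ⟨αK, hαK, -⟩ := exists_preimage_root_trace ι hδ₀ h
  exact ⟨αK, hαK⟩

end Trace

end Summit.BirchSwinnertonDyer.BirchSwinnertonDyer.Theorems.PSUntwistedTrace
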